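import Summits.Langlands.Langlands.Theorems.PhantomRMYoshidaResiduallyYoshidaLiftingRealisedClassSelmerDec
import HarnessLib

/-!
# RESIDUAL CONSTANCY ON RANK-ONE FIBRES (stub `stub_residualConstancyOfRankOne`, RC) — line `sector-klingen-split`,
# crux `ResiduallyYoshidaLifting` (stmt-Langlands-13639)

Lead prover-line-stmt-Langlands-13639-c5-0 (continuation c5, skeleton rev 14, 2026-08-17).

**Theorem (`stub_residualConstancyOfRankOne`, registered signature verbatim; the `let`-abbreviations `GrDec` — the nine-clause
decomposition-group Greenberg condition of N1⁺ at `v ∣ p` — and `Fr` — "realised through the integral frame `(Q, ri)` with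
reduction conjugator `hh`" — only keep the registered text under the registry's length cap).**  On a `DetC` fibre (`p ≠ 2`) let
`ρ₁, ρ₂` be two `Sh`-points, unramified outside `S`, realising NON-trivial classes `B₁, B₂` through integral frames
`(P₁, rint₁, h₁)`, `(P₂, rint₂, h₂)`.  IF the strong (decomposition-group) Greenberg–Selmer cocycles with ramification inside `S`
that are not coboundaries are pairwise projectively equal modulo coboundaries (rank one), THEN the two residual representations
are conjugate: `red ∘ rint₂ = g (red ∘ rint₁) g⁻¹` for one `g ∈ GL₄(k)` — one residual representation, hence ONE deformation ring,
governs the whole fibre (the starting point of Berger–Klosin's method).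

**Proof.**  K3⁺ (`Fibre.stub_realisedClassSelmerDec`, p168375) makes both `B₁` and `B₂` strong Greenberg–Selmer cocycles for
`S`; rank one gives `B₂ = c • B₁ + (σ̄ X - X σ̄')` with `c ∈ kˣ`; the block identity
`(σ̄, c B₁ + σ̄ X - X σ̄'; 0, σ̄') · U = U · (σ̄, B₁; 0, σ̄')` with `U = (c, -X; 0, 1)` (`det U = c² ≠ 0`), transported along
`finSumFinEquiv`, gives the conjugator `g := h₂ U h₁⁻¹`.  No new definitions, no named fact taken as a hypothesis.
-/

noncomputable section

-- `Summit.Langlands.Langlands.…` (summit = sub-problem name, D-0017 layout) trips `dupNamespace` on every decl.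
set_option linter.dupNamespace false
set_option autoImplicit false

open IsDedekindDomain Filter
open scoped Matrix
open Literature.NumberTheory.GaloisRepresentations Literature.NumberTheory.Automorphic
open Summit.Langlands.Langlands.Cruxes.ResiduallyYoshidaLifting.YoshidaDivisorSelmerCount

namespace Summit.Langlands.Langlands.Cruxes.ResiduallyYoshidaLifting.SectorKlingenSplit.Fibre

/-- The block intertwining identity behind residual constancy: for `U = (c • 1, -X; 0, 1)`,
`(S, c • B + (S X - X S'); 0, S') · U = U · (S, B; 0, S')`. [folklore] -/
private theorem fromBlocks_twist_mul_conjugator {R : Type*} [CommRing R] {n : Type*} [Fintype n] [DecidableEq n]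
    (S S' B X : Matrix n n R) (c : R) :
    Matrix.fromBlocks S (c • B + (S * X - X * S')) 0 S' * Matrix.fromBlocks (c • (1 : Matrix n n R)) (-X) 0 1 =
      Matrix.fromBlocks (c • (1 : Matrix n n R)) (-X) 0 1 * Matrix.fromBlocks S B 0 S' := by
  simp only [Matrix.fromBlocks_multiply, Matrix.mul_smul, Matrix.smul_mul, Matrix.mul_one, Matrix.one_mul,
    Matrix.mul_zero, Matrix.zero_mul, add_zero, zero_add, smul_zero, Matrix.mul_neg, Matrix.neg_mul, neg_zero]
  rw [Matrix.fromBlocks_inj]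
  exact ⟨rfl, by abel, rfl, rfl⟩

/-- `Matrix.reindex` along one equivalence is multiplicative. [folklore] -/
private theorem reindex_mul_reindex {R : Type*} [CommRing R] {m o : Type*} [Fintype m] [Fintype o]
    (e : m ≃ o) (M N : Matrix m m R) :
    Matrix.reindex e e M * Matrix.reindex e e N = Matrix.reindex e e (M * N) := by
  simp only [Matrix.reindex_apply, Matrix.submatrix_mul_equiv]

/-- The conjugator `U = (c • 1, -X; 0, 1)` transported to `Fin 4` is invertible for `c ∈ kˣ`. [folklore] -/
private theorem det_reindex_conjugator_ne_zero {k : Type*} [Field k] (c : kˣ) (X : Matrix (Fin 2) (Fin 2) k) :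
    (Matrix.reindex finSumFinEquiv finSumFinEquiv
        (Matrix.fromBlocks ((c : k) • (1 : Matrix (Fin 2) (Fin 2) k)) (-X) 0 (1 : Matrix (Fin 2) (Fin 2) k)) :
      Matrix (Fin 4) (Fin 4) k).det ≠ 0 := by
  rw [Matrix.det_reindex_self, Matrix.det_fromBlocks_zero₂₁, Matrix.det_smul, Matrix.det_one, mul_one, mul_one,
    Fintype.card_fin]
  exact pow_ne_zero _ c.ne_zero

/-- **Registered sub-goal RC `stub_residualConstancyOfRankOne`** (crux stmt-Langlands-13639, line `sector-klingen-split`, skeleton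
rev 14): RESIDUAL CONSTANCY ON RANK-ONE FIBRES.  Two `Sh`-points `ρ₁, ρ₂` on a `DetC` fibre (`p ≠ 2`), unramified outside `S`,
realising NON-trivial classes `B₁, B₂` through integral frames, on a fibre whose strong (decomposition-group) Greenberg–Selmer
cocycles with ramification inside `S` are projectively cyclic, have CONJUGATE residual representations:
`red ∘ rint₂ = g (red ∘ rint₁) g⁻¹` for one `g ∈ GL₄(k)` (K3⁺ for both, rank one gives `B₂ = c B₁ + δX`, and
`(σ̄, c B₁ + δX; 0, σ̄') = U (σ̄, B₁; 0, σ̄') U⁻¹` with `U = (1, -X; 0, 1)(c, 0; 0, 1)`). [folklore] -/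
theorem stub_residualConstancyOfRankOne :
    ∀ (p : ℕ) [Fact p.Prime], p ≠ 2 → ∀ (k : Type) [Field k] [CharP k p] [IsAlgClosed k]
    [TopologicalSpace k] [DiscreteTopology k] (red : Valued.integer (PadicAlgCl p) →+* k)
    (σ σ' : FramedGaloisRep ℚ k 2) (ρ₁ ρ₂ : FramedGaloisRep ℚ (PadicAlgCl p) 4) (P₁ P₂ : GL (Fin 4) (PadicAlgCl p))
    (rint₁ rint₂ : Field.absoluteGaloisGroup ℚ →* GL (Fin 4) (Valued.integer (PadicAlgCl p))) (h₁ h₂ : GL (Fin 4) k)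
    (B₁ B₂ : Field.absoluteGaloisGroup ℚ → Matrix (Fin 2) (Fin 2) k) (S : Set (HeightOneSpectrum (NumberField.RingOfIntegers ℚ))),
    let GrDec := fun A (v : HeightOneSpectrum (NumberField.RingOfIntegers ℚ)) =>
      ∃ (X₀ : Matrix (Fin 2) (Fin 2) k) (x₁ y₁ : Fin 2 → k), x₁ ≠ 0 ∧ y₁ ≠ 0 ∧
        (∀ τ : Field.absoluteGaloisGroup (v.adicCompletion ℚ), ∃ a : k,
          (σ (absGaloisRestrict ℚ (v.adicCompletion ℚ) τ)).val *ᵥ x₁ = a • x₁) ∧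
        (∀ τ : Field.absoluteGaloisGroup (v.adicCompletion ℚ), ∃ b : k,
          (σ' (absGaloisRestrict ℚ (v.adicCompletion ℚ) τ)).val *ᵥ y₁ = b • y₁) ∧
        (∀ τ : Field.absoluteGaloisGroup (v.adicCompletion ℚ), ∃ c : k,
          (A (absGaloisRestrict ℚ (v.adicCompletion ℚ) τ) -
            ((σ (absGaloisRestrict ℚ (v.adicCompletion ℚ) τ)).val * X₀ -
              X₀ * (σ' (absGaloisRestrict ℚ (v.adicCompletion ℚ) τ)).val)) *ᵥ y₁ = c • x₁) ∧
        (∀ τ ∈ absInertia (v.adicCompletion ℚ),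
          (σ (absGaloisRestrict ℚ (v.adicCompletion ℚ) τ)).val *ᵥ x₁ = x₁) ∧
        (∀ τ ∈ absInertia (v.adicCompletion ℚ),
          (σ' (absGaloisRestrict ℚ (v.adicCompletion ℚ) τ)).val *ᵥ y₁ = y₁) ∧
        (∀ τ ∈ absInertia (v.adicCompletion ℚ),
          (A (absGaloisRestrict ℚ (v.adicCompletion ℚ) τ) -
            ((σ (absGaloisRestrict ℚ (v.adicCompletion ℚ) τ)).val * X₀ -
              X₀ * (σ' (absGaloisRestrict ℚ (v.adicCompletion ℚ) τ)).val)) *ᵥ y₁ = 0) ∧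
        ∀ τ ∈ absInertia (v.adicCompletion ℚ), ∀ y : Fin 2 → k, ∃ c : k,
          (A (absGaloisRestrict ℚ (v.adicCompletion ℚ) τ) -
            ((σ (absGaloisRestrict ℚ (v.adicCompletion ℚ) τ)).val * X₀ -
              X₀ * (σ' (absGaloisRestrict ℚ (v.adicCompletion ℚ) τ)).val)) *ᵥ y = c • x₁
    let Fr := fun (r : FramedGaloisRep ℚ (PadicAlgCl p) 4) (Q : GL (Fin 4) (PadicAlgCl p))
        (ri : Field.absoluteGaloisGroup ℚ →* GL (Fin 4) (Valued.integer (PadicAlgCl p))) (hh : GL (Fin 4) k) A =>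
      (∀ g, Matrix.GeneralLinearGroup.map (Valued.integer (PadicAlgCl p)).subtype (ri g) = Q⁻¹ * r g * Q) ∧
        (∀ g, (Matrix.GeneralLinearGroup.map red (ri g)).val =
          hh.val * Matrix.reindex finSumFinEquiv finSumFinEquiv
            (Matrix.fromBlocks (σ g).val (A g) 0 (σ' g).val) * (hh⁻¹).val)
    DetC p k σ σ' → Sh p k red σ σ' ρ₁ → Sh p k red σ σ' ρ₂ →
    Fr ρ₁ P₁ rint₁ h₁ B₁ → Fr ρ₂ P₂ rint₂ h₂ B₂ →
    (¬ ∃ X : Matrix (Fin 2) (Fin 2) k, ∀ g, B₁ g = (σ g).val * X - X * (σ' g).val) →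
    (¬ ∃ X : Matrix (Fin 2) (Fin 2) k, ∀ g, B₂ g = (σ g).val * X - X * (σ' g).val) →
    (∀ v ∉ S, ρ₁.IsUnramifiedAt v ∧ ρ₂.IsUnramifiedAt v) →
    (∀ A₁ A₂ : Field.absoluteGaloisGroup ℚ → Matrix (Fin 2) (Fin 2) k,
      (∀ g g', A₁ (g * g') = (σ g).val * A₁ g' + A₁ g * (σ' g').val) →
      (∀ g g', A₂ (g * g') = (σ g).val * A₂ g' + A₂ g * (σ' g').val) →
      IsLocallyConstant A₁ → IsLocallyConstant A₂ →
      (∀ v ∉ S, ∀ 𝔓 ∈ v.primesAbove, ∀ i ∈ 𝔓.inertia (Field.absoluteGaloisGroup ℚ), A₁ i = 0 ∧ A₂ i = 0) →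
      (∀ v : HeightOneSpectrum (NumberField.RingOfIntegers ℚ), ((p : ℕ) : NumberField.RingOfIntegers ℚ) ∈ v.asIdeal →
        GrDec A₁ v ∧ GrDec A₂ v) →
      (¬ ∃ X : Matrix (Fin 2) (Fin 2) k, ∀ g, A₁ g = (σ g).val * X - X * (σ' g).val) →
      (¬ ∃ X : Matrix (Fin 2) (Fin 2) k, ∀ g, A₂ g = (σ g).val * X - X * (σ' g).val) →
      ∃ (c : kˣ) (X : Matrix (Fin 2) (Fin 2) k), ∀ g, A₂ g = (c : k) • A₁ g + ((σ g).val * X - X * (σ' g).val)) →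
    ∃ g : GL (Fin 4) k, ∀ γ,
      Matrix.GeneralLinearGroup.map red (rint₂ γ) = g * Matrix.GeneralLinearGroup.map red (rint₁ γ) * g⁻¹ := by
  intro p _ hp k _ _ _ _ _ red σ σ' ρ₁ ρ₂ P₁ P₂ rint₁ rint₂ h₁ h₂ B₁ B₂ S GrDec Fr hdet hSh₁ hSh₂ hFr₁ hFr₂ hB₁ hB₂ hS hrank
  obtain ⟨hP₁, hred₁⟩ := hFr₁
  obtain ⟨hP₂, hred₂⟩ := hFr₂
  -- both realised classes are strong Greenberg–Selmer cocycles (K3⁺)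
  obtain ⟨hcoc₁, hlc₁, hur₁, hgr₁⟩ :=
    stub_realisedClassSelmerDec p hp k red σ σ' ρ₁ P₁ rint₁ h₁ B₁ hdet hSh₁ hP₁ hred₁
  obtain ⟨hcoc₂, hlc₂, hur₂, hgr₂⟩ :=
    stub_realisedClassSelmerDec p hp k red σ σ' ρ₂ P₂ rint₂ h₂ B₂ hdet hSh₂ hP₂ hred₂
  -- rank one: `B₂` is projectively equal to `B₁` modulo coboundaries
  obtain ⟨c, X, hcX⟩ := hrank B₁ B₂ hcoc₁ hcoc₂ hlc₁ hlc₂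
    (fun v hv 𝔓 h𝔓 i hi => ⟨hur₁ v (hS v hv).1 𝔓 h𝔓 i hi, hur₂ v (hS v hv).2 𝔓 h𝔓 i hi⟩)
    (fun v hv => ⟨hgr₁ v hv, hgr₂ v hv⟩) hB₁ hB₂
  -- the conjugator `U = (c • 1, -X; 0, 1)` on `Fin 4`, as an element of `GL₄(k)`
  set U : Matrix (Fin 4) (Fin 4) k := Matrix.reindex finSumFinEquiv finSumFinEquiv
    (Matrix.fromBlocks ((c : k) • (1 : Matrix (Fin 2) (Fin 2) k)) (-X) 0 (1 : Matrix (Fin 2) (Fin 2) k)) with hU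
  have hUdet : U.det ≠ 0 := det_reindex_conjugator_ne_zero c X
  -- the block identity, transported along `finSumFinEquiv`
  have key : ∀ γ, Matrix.reindex finSumFinEquiv finSumFinEquiv
      (Matrix.fromBlocks (σ γ).val (B₂ γ) 0 (σ' γ).val) * U =
        U * Matrix.reindex finSumFinEquiv finSumFinEquiv (Matrix.fromBlocks (σ γ).val (B₁ γ) 0 (σ' γ).val) := by
    intro γ
    rw [hU, reindex_mul_reindex, reindex_mul_reindex, hcX γ, fromBlocks_twist_mul_conjugator]
  refine ⟨h₂ * Matrix.GeneralLinearGroup.mkOfDetNeZero U hUdet * h₁⁻¹, fun γ => ?_⟩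
  rw [eq_mul_inv_iff_mul_eq]
  apply Units.ext
  simp only [Units.val_mul, Matrix.GeneralLinearGroup.val_mkOfDetNeZero, hred₁ γ, hred₂ γ, Matrix.mul_assoc,
    Units.inv_mul_cancel_left]
  rw [← Matrix.mul_assoc _ U, key γ, Matrix.mul_assoc]

end Summit.Langlands.Langlands.Cruxes.ResiduallyYoshidaLifting.SectorKlingenSplit.Fibre

end
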